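import Mathlib.AlgebraicGeometry.FunctionField
import Mathlib.RingTheory.IntegralClosure.IntegrallyClosed
import HarnessLib

/-!
# Sections of a normal integral scheme are integrally closed in the function field

Topic: `Literature/AlgebraicGeometry/Resolution`. For an integral scheme `X` all of whose local
rings are integrally closed (a normal variety, de Jong 1996, 2.9 / (v)) and a non-empty open
`U ⊆ X`, every element of the function field `K(X)` integral over `Γ(X, U)` is a section over
`U` (`exists_germToFunctionField_eq_of_isIntegral`, `mem_range_of_isIntegral_sections`): it is
integral over, hence lies in, every local ring `𝒪_{X,x}`, `x ∈ U` (scalar tower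
`Γ(X, U) → 𝒪_{X,x} → K(X)`, Mathlib `functionField_isScalarTower`, and
`IsFractionRing 𝒪_{X,x} K(X)`), so it is represented around each point of `U` by a local section;
two such local sections agree on overlaps because restriction to the generic point is injective
(`Scheme.germToFunctionField_injective`), and the sheaf glues them.

This is the input "`X'` is normal" of de Jong 1996, 4.12 ("Note that `X'` is normal also. […]
`Y' → ℙ^{d-1}` is (finite) étale"): the ring `Γ(f⁻¹V, 𝒪_{X'})` of the Stein factorisation is
integrally closed in `K(X')` although `f⁻¹V` is not affine. [folklore] throughout; no definitions,
no named facts.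

## Sources

* A. J. de Jong, *Smoothness, semi-stability and alterations*, Publ. Math. IHÉS 83 (1996), 4.12,
  p. 68. [DeJong1996]
* The Stacks Project, Tag 0358 (normal integral schemes: `𝒪_X(U)` is a normal domain).
-/

noncomputable section

open CategoryTheory AlgebraicGeometry TopologicalSpace Opposite

namespace Literature.AlgebraicGeometry.Resolution

universe u

/-- **A rational function integral over `Γ(X, U)` is a section over `U`** (`X` integral with
integrally closed local rings, `U` non-empty open): it lies in every local ring `𝒪_{X,x}`,
`x ∈ U`, and the local representatives glue. [folklore] -/
theorem exists_germToFunctionField_eq_of_isIntegral {X : Scheme.{u}} [IsIntegral X]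
    (hN : ∀ x : X, IsIntegrallyClosed (X.presheaf.stalk x)) (U : X.Opens) [Nonempty U]
    (z : X.functionField) (hz : IsIntegral Γ(X, U) z) :
    ∃ s : Γ(X, U), X.germToFunctionField U s = z := by
  classical
  -- `z` is regular at every point of `U`
  have hreg : ∀ x : U, ∃ g : X.presheaf.stalk (x : X),
      algebraMap (X.presheaf.stalk (x : X)) X.functionField g = z := by
    intro x
    haveI := functionField_isScalarTower X U x
    haveI := hN (x : X)
    have hz' : IsIntegral (X.presheaf.stalk (x : X)) z := hz.tower_top
    exact IsIntegrallyClosed.algebraMap_eq_of_integral hz'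
  choose g hg using hreg
  -- each germ is represented by a section on a neighbourhood inside `U`
  have hsec : ∀ x : U, ∃ (W : X.Opens) (hxW : (x : X) ∈ W) (_ : W ≤ U) (t : Γ(X, W)),
      X.presheaf.germ W x hxW t = g x := by
    intro x
    obtain ⟨W', hxW', t', ht'⟩ := X.presheaf.exists_germ_eq (g x)
    refine ⟨W' ⊓ U, ⟨hxW', x.2⟩, inf_le_right, X.presheaf.map (homOfLE inf_le_left).op t', ?_⟩
    rw [TopCat.Presheaf.germ_res_apply]
    exact ht'
  choose W hxW hWU t ht using hsec
  -- the germ of `t x` at the generic point is `z`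
  have hgen : ∀ x : U, X.germToFunctionField (W x) (h := ⟨⟨(x : X), hxW x⟩⟩) (t x) = z := by
    intro x
    haveI : Nonempty (W x) := ⟨⟨(x : X), hxW x⟩⟩
    rw [← Scheme.algebraMap_germ_eq_germToFunctionField X (hxW x) (t x), ht, hg]
  -- compatibility on overlaps: both restrictions have germ `z` at the generic point
  have hcompat : TopCat.Presheaf.IsCompatible X.presheaf W t := by
    intro i j
    have hne : ((W i ⊓ W j : X.Opens) : Set X).Nonempty :=
      nonempty_preirreducible_inter (W i).isOpen (W j).isOpen ⟨_, hxW i⟩ ⟨_, hxW j⟩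
    haveI : Nonempty (W i ⊓ W j : X.Opens) := ⟨⟨_, hne.some_mem⟩⟩
    apply X.germToFunctionField_injective (W i ⊓ W j)
    change X.germToFunctionField (W i ⊓ W j) (X.presheaf.map (homOfLE inf_le_left).op (t i)) =
      X.germToFunctionField (W i ⊓ W j) (X.presheaf.map (homOfLE inf_le_right).op (t j))
    dsimp only [Scheme.germToFunctionField]
    rw [TopCat.Presheaf.germ_res_apply, TopCat.Presheaf.germ_res_apply]
    exact (hgen i).trans (hgen j).symm
  -- glue
  have hcover : U ≤ iSup W := fun x hx => Opens.mem_iSup.mpr ⟨⟨x, hx⟩, hxW ⟨x, hx⟩⟩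
  obtain ⟨s, hs, -⟩ :=
    TopCat.Sheaf.existsUnique_gluing' X.sheaf W U (fun x => homOfLE (hWU x)) hcover t hcompat
  refine ⟨s, ?_⟩
  obtain ⟨x₀⟩ := ‹Nonempty U›
  have h1 : X.presheaf.map (homOfLE (hWU x₀)).op s = t x₀ := hs x₀
  have h2 := hgen x₀
  rw [← h1] at h2
  dsimp only [Scheme.germToFunctionField] at h2 ⊢
  rwa [TopCat.Presheaf.germ_res_apply] at h2

/-- Range form: for `X` integral with integrally closed local rings and `U ⊆ X` non-empty open,
`Γ(X, U)` is integrally closed in `K(X)` — every `z ∈ K(X)` integral over `Γ(X, U)` is in the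
image of `Γ(X, U) → K(X)`. [folklore] -/
theorem mem_range_of_isIntegral_sections {X : Scheme.{u}} [IsIntegral X]
    (hN : ∀ x : X, IsIntegrallyClosed (X.presheaf.stalk x)) (U : X.Opens) [Nonempty U]
    (z : X.functionField) (hz : IsIntegral Γ(X, U) z) :
    z ∈ (algebraMap Γ(X, U) X.functionField).range := by
  obtain ⟨s, hs⟩ := exists_germToFunctionField_eq_of_isIntegral hN U z hz
  exact ⟨s, hs⟩

/-- Equivalently, `Γ(X, U)` is integrally closed in `K(X)` (`IsIntegrallyClosedIn`). [folklore] -/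
theorem isIntegrallyClosedIn_sections {X : Scheme.{u}} [IsIntegral X]
    (hN : ∀ x : X, IsIntegrallyClosed (X.presheaf.stalk x)) (U : X.Opens) [Nonempty U] :
    IsIntegrallyClosedIn Γ(X, U) X.functionField := by
  refine (isIntegrallyClosedIn_iff (R := Γ(X, U)) (A := X.functionField)).mpr
    ⟨X.germToFunctionField_injective U, fun {z} hz => ?_⟩
  obtain ⟨s, hs⟩ := exists_germToFunctionField_eq_of_isIntegral hN U z hz
  exact ⟨s, hs⟩

/-- The integral closure of `Γ(X, U)` in `K(X)` is (the image of) `Γ(X, U)`: the canonical map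
`Γ(X, U) → integralClosure Γ(X, U) K(X)` is bijective. This is the form consumed through
Stacks 03GE (`TensorProduct.toIntegralClosure_bijective_of_smooth`). [folklore] -/
theorem bijective_algebraMap_integralClosure_sections {X : Scheme.{u}} [IsIntegral X]
    (hN : ∀ x : X, IsIntegrallyClosed (X.presheaf.stalk x)) (U : X.Opens) [Nonempty U] :
    Function.Bijective (algebraMap Γ(X, U) (integralClosure Γ(X, U) X.functionField)) := by
  refine ⟨fun a b h => X.germToFunctionField_injective U (congrArg Subtype.val h), fun w => ?_⟩
  obtain ⟨s, hs⟩ := exists_germToFunctionField_eq_of_isIntegral hN U w.1 w.2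
  exact ⟨s, Subtype.ext hs⟩

end Literature.AlgebraicGeometry.Resolution

end
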